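import Literature.Analysis.FluidPDE.CompressibleEulerHomogeneousEnergyDefs
import HarnessLib

/-!
# The derivative-only level-`3` energy of a slice with pointwise bounded derivatives

Analysis/FluidPDE support file (theorems only; no named facts). Companion of
`CompressibleEulerHomogeneousEnergyDefs.lean`: the bookkeeping bound used at time `0` in the
fixed-horizon stability estimate (layer 4 of Kato's continuous-dependence theorem, Kato 1975
Thm III, for the compressible Euler family on `𝕋³`). If all nested partial derivatives
`∂^w ρ(t), ∂^w u(t), ∂^w ϑ(t)` of orders `1 ≤ |w| ≤ 3` of a smooth slice are bounded by `B`
pointwise, then each word energy `N_w(t) = ∫ (∂^wρ)² + Σₖ ∫ (∂^wuₖ)² + ∫ (∂^wϑ)²` is at most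
`B² + 3B² + B² = 5B²` (`𝕋³ = UnitAddTorus (Fin 3)` has unit volume, and
`|∂^w uₖ| = |(∂^w u)ₖ| ≤ ‖∂^w u‖`), and summing over the `3 + 9 + 27 = 39` nonempty words of
length `≤ 3` (`sum_card_words_Icc_one_three`),
`D₃(t) = derivLevelEnergy ρ u ϑ 3 t ≤ 39 · 5 B² = 195 B² ≤ 200 B²`.

* `wordEnergy_le_of_pointwise` — `N_w(t) ≤ 5 B²` from the pointwise bound on the word `w`;
* `derivLevelEnergy_three_le_of_pointwise` — `D₃(t) ≤ 200 B²`.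

## References

* T. Kato, The Cauchy problem for quasi-linear symmetric hyperbolic systems, Arch. Rational
  Mech. Anal. 58 (1975) 181–205, Thm III. [Kato1975]
* A. Majda, *Compressible Fluid Flow and Systems of Conservation Laws in Several Space
  Variables*, Springer 1984, Ch. 2 §2.1, Thm 2.2 (2.38). [Majda1984]
-/

noncomputable section

open Set Function MeasureTheory Filter
open scoped ContDiff Topology

namespace Literature.Analysis.FluidPDE

namespace CompressibleEuler

open Literature.Analysis.FunctionSpaces Literature.Analysis.FunctionSpaces.Torus

/-- **A word energy of a slice with pointwise bounded word derivatives.** If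
`|∂^w ρ(t)|, ‖∂^w u(t)‖, |∂^w ϑ(t)| ≤ B` pointwise for smooth slices `ρ t, u t, ϑ t`, then
`N_w(t) = wordEnergy ρ u ϑ w t ≤ 5 B²` (unit volume; three velocity components, each bounded by
the Euclidean norm). [folklore] -/
theorem wordEnergy_le_of_pointwise {ρ ϑ : ℝ → UnitAddTorus (Fin 3) → ℝ}
    {u : ℝ → UnitAddTorus (Fin 3) → EuclideanSpace ℝ (Fin 3)} {t B : ℝ} {w : List (Fin 3)}
    (hρ : IsSmooth (ρ t)) (hϑ : IsSmooth (ϑ t)) (hu : IsSmooth (u t))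
    (hb : ∀ x, |iterPartialDeriv w (ρ t) x| ≤ B ∧ ‖iterPartialDeriv w (u t) x‖ ≤ B ∧
      |iterPartialDeriv w (ϑ t) x| ≤ B) :
    wordEnergy ρ u ϑ w t ≤ 5 * B ^ 2 := by
  -- adapted from `levelEnergy_three_le_of_wordBounds` (IsentropicEulerUniformLifespan.lean)
  have h1 : ∫ y, iterPartialDeriv w (ρ t) y ^ 2 ≤ B ^ 2 :=
    integral_sq_le_sq_of_abs_le (hρ.iterPartialDeriv w).continuous fun x => (hb x).1
  have h3 : ∫ y, iterPartialDeriv w (ϑ t) y ^ 2 ≤ B ^ 2 :=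
    integral_sq_le_sq_of_abs_le (hϑ.iterPartialDeriv w).continuous fun x => (hb x).2.2
  have h2 : ∀ k, ∫ y, iterPartialDeriv w (fun y => u t y k) y ^ 2 ≤ B ^ 2 := by
    intro k
    have hfun : (fun y => iterPartialDeriv w (fun y => u t y k) y) =
        fun y => iterPartialDeriv w (u t) y k := by
      funext y; exact iterPartialDeriv_apply_coord hu w y k
    have hcont : Continuous fun y => iterPartialDeriv w (u t) y k :=
      (EuclideanSpace.proj k).continuous.comp (hu.iterPartialDeriv w).continuous
    have hbk : ∀ x, |iterPartialDeriv w (u t) x k| ≤ B :=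
      fun x => (abs_apply_le_norm _ k).trans (hb x).2.1
    have := integral_sq_le_sq_of_abs_le hcont hbk
    simpa only [hfun] using this
  have h2' : ∑ k, ∫ y, iterPartialDeriv w (fun y => u t y k) y ^ 2 ≤ 3 * B ^ 2 := by
    calc ∑ k, ∫ y, iterPartialDeriv w (fun y => u t y k) y ^ 2 ≤ ∑ _k : Fin 3, B ^ 2 :=
          Finset.sum_le_sum fun k _ => h2 k
      _ = 3 * B ^ 2 := by simp
  unfold wordEnergy
  linarith

/-- **The derivative-only level-`3` energy of a slice with pointwise bounded derivatives
(layer 4c of the fixed-horizon stability estimate in Kato's continuous-dependence theorem for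
the hard-sphere Euler family).** If all nested partial derivatives of orders `1 ≤ |w| ≤ 3` of
the smooth slices `ρ t, u t, θ t` are bounded by `B ≥ 0` pointwise, then
`derivLevelEnergy ρ u θ 3 t ≤ 200 B²` (`39` nonempty words of length `≤ 3`, `5 B²` each).
[folklore] -/
theorem derivLevelEnergy_three_le_of_pointwise :
    ∀ (ρ θ : ℝ → UnitAddTorus (Fin 3) → ℝ) (u : ℝ → UnitAddTorus (Fin 3) → EuclideanSpace ℝ (Fin 3))
      (t B : ℝ), 0 ≤ B →
      Torus.IsSmooth (ρ t) → Torus.IsSmooth (θ t) → Torus.IsSmooth (u t) →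
      (∀ w : List (Fin 3), 1 ≤ w.length → w.length ≤ 3 → ∀ x,
          |Torus.iterPartialDeriv w (ρ t) x| ≤ B ∧ ‖Torus.iterPartialDeriv w (u t) x‖ ≤ B ∧
            |Torus.iterPartialDeriv w (θ t) x| ≤ B) →
      CompressibleEuler.derivLevelEnergy ρ u θ 3 t ≤ 200 * B ^ 2 := by
  intro ρ θ u t B _hB hρ hθ hu hb
  have hword : ∀ n ∈ Finset.Icc 1 3, ∀ w : Fin n → Fin 3,
      wordEnergy ρ u θ (List.ofFn w) t ≤ 5 * B ^ 2 := by
    intro n hn w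
    have hn' := Finset.mem_Icc.1 hn
    exact wordEnergy_le_of_pointwise hρ hθ hu
      (hb (List.ofFn w) (by rw [List.length_ofFn]; exact hn'.1)
        (by rw [List.length_ofFn]; exact hn'.2))
  unfold derivLevelEnergy
  calc ∑ n ∈ Finset.Icc 1 3, ∑ w : Fin n → Fin 3, wordEnergy ρ u θ (List.ofFn w) t
      ≤ ∑ n ∈ Finset.Icc 1 3, ∑ _w : Fin n → Fin 3, 5 * B ^ 2 :=
        Finset.sum_le_sum fun n hn => Finset.sum_le_sum fun w _ => hword n hn w
    _ = (∑ n ∈ Finset.Icc 1 3, ((Finset.univ : Finset (Fin n → Fin 3)).card : ℝ)) *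
          (5 * B ^ 2) := by
        rw [Finset.sum_mul]
        refine Finset.sum_congr rfl fun n _ => ?_
        rw [Finset.sum_const, nsmul_eq_mul]
    _ = 39 * (5 * B ^ 2) := by rw [sum_card_words_Icc_one_three]
    _ ≤ 200 * B ^ 2 := by nlinarith [sq_nonneg B]

end CompressibleEuler

end Literature.Analysis.FluidPDE

end
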